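import Summits.Ventures.HSemireg.WedgeHankelRecurrenceGaussChebyshevElectrostatic

/-!
# Venture HSemireg — **SUM RULES FOR THE CLASSICAL ZEROS FROM STIELTJES' EQUILIBRIA**: summing `Σ_{j≠k} 1∕(x_k − x_j)` over `k` gives `0`, summing `x_k Σ_{j≠k} 1∕(x_k − x_j)` gives the number of
# pairs `t(t+1)∕2` (antisymmetry ∕ pair symmetrization); with N389 ∕ N392 this yields **LAGUERRE `Σ_k 1∕x_k = (t+1)∕(α+1)`**, **GEGENBAUER `Σ_k 1∕(1 − x_k²) = (t+1)(t+1+2λ)∕(2λ+1)`** and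
# **LEGENDRE `Σ_k 1∕(1 − x_k²) = (t+1)(t+2)∕2`** for the zeros of `L^{(α)}_{t+1}`, `C^{(λ)}_{t+1}`, `P_{t+1}`

HONEST FRAMING. Part of the Lean index of the computation cell `pub-hsemireg` (seat p10 gen 46, Sunday typer «UNIFORM-IN-n»).  Finite double sums only; no variety, no cohomology theory, no sheaf, no Ext
group and no semiregularity map is constructed here; nothing here says that HC / HC_CM / HC_AV holds; no Literature fact (unproved `Prop`) is declared or used.  Custodian versions as in
`WedgeHankelSiegelIdeal` (1/3).
SOURCES (cited).  G. Szegő, *Orthogonal Polynomials*, §6.7 (and Problems 27–30); S. Ahmed, M. Bruschi, F. Calogero, M. A. Olshanetsky, A. M. Perelomov, Nuovo Cimento B 49 (1979) 173–199 (sum rules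
for the zeros of the classical polynomials, e.g. `Σ 1∕x_k = n∕(α+1)` for Laguerre, `Σ 1∕(1−x_k²)` for Jacobi); K. M. Case, *Sum rules for zeros of polynomials I*, J. Math. Phys. 21 (1980) 702–708.
PROOF TYPED HERE.  `Σ_k Σ_{j≠k} g(k,j) = Σ_k Σ_{j≠k} g(j,k)` (swap), so the double sum of `1∕(x_k − x_j)` vanishes and that of `x_k∕(x_k − x_j)` is half of `Σ_{k≠j} 1 = (t+1)t`; then sum the identities
of N389 (`2x_k S_k = x_k − α − 1`, i.e. `S_k = ½ − (α+1)∕(2x_k)`) and N392 (`2(1 − x_k²) S_k = (2λ+1) x_k`, i.e. `x_k S_k = (2λ+1)∕2 · x_k²∕(1−x_k²)`).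
DEDUP DISCLOSURE (`rg -n -i 'sum_inv_zeros|sum_rule|one_sub_sq' Summits/Ventures/HSemireg/WedgeHankelRecurrenceGauss*`, 2026-09-03): N394 (second moments via traces); the reciprocal sum rules are new.
The 5 names below: 0 hits tree-wide.

WHAT IS IN THE TREE.  N389 `laguerre_zeros_electrostatic`; N392 `gegenbauer_zeros_electrostatic`, `legendre_zeros_electrostatic`; Mathlib `Finset.sum_comm`, `Finset.sum_ite_eq`.
THIS FILE (namespace `Summit.Ventures.HSemireg.Wedge.HankelOuter` continued; CHAINED on N397 (import only); 0 definitions):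
* §1163 `sum_sum_erase_antisymm` (antisymmetric kernels sum to `0`), `sum_sum_erase_mul_inv_sub` (`Σ_k Σ_{j≠k} x_k∕(x_k − x_j) = (t+1)t∕2`), **`laguerre_zeros_sum_inv`** (`Σ 1∕x_k = (t+1)∕(α+1)`),
  **`gegenbauer_zeros_sum_inv_one_sub_sq`**, **`legendre_zeros_sum_inv_one_sub_sq`** (`Σ 1∕(1−x_k²) = (t+1)(t+2)∕2`).
CAVEATS.  The zeros enter through the hypotheses of N389 ∕ N392 (recurrence data, product form).  Nothing Ext-side.  New names only.
-/

open Module Polynomial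
open scoped Matrix Polynomial

namespace Summit.Ventures.HSemireg.Wedge.HankelOuter

/-! ## §1163. Sum rules from the equilibrium identities -/

/-- **Antisymmetric double sums vanish: `Σ_k Σ_{j ≠ k} g(k, j) = 0` when `g(k, j) = −g(j, k)`.** [bookkeeping; this file, §1163] -/
theorem sum_sum_erase_antisymm {N : ℕ} (g : Fin N → Fin N → ℝ) (hg : ∀ k j, g k j = -g j k) : ∑ k, ∑ j ∈ Finset.univ.erase k, g k j = 0 := by
  classical
  have hext : ∀ k : Fin N, ∑ j ∈ Finset.univ.erase k, g k j = ∑ j, if j = k then 0 else g k j := fun k => by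
    rw [← Finset.sum_erase_add _ _ (Finset.mem_univ k), if_pos rfl, add_zero]
    exact Finset.sum_congr rfl fun j hj => by rw [if_neg (Finset.mem_erase.1 hj).1]
  simp_rw [hext]
  have hswap : ∑ k : Fin N, ∑ j : Fin N, (if j = k then (0 : ℝ) else g k j) = ∑ k : Fin N, ∑ j : Fin N, (if j = k then (0 : ℝ) else g j k) := by
    rw [Finset.sum_comm]
    exact Finset.sum_congr rfl fun k _ => Finset.sum_congr rfl fun j _ => by
      by_cases h : j = k
      · rw [if_pos h, if_pos h.symm]
      · rw [if_neg h, if_neg (Ne.symm h)]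
  have hsum : ∑ k : Fin N, ∑ j : Fin N, (if j = k then (0 : ℝ) else g k j) + ∑ k : Fin N, ∑ j : Fin N, (if j = k then (0 : ℝ) else g j k) = 0 := by
    rw [← Finset.sum_add_distrib]
    refine Finset.sum_eq_zero fun k _ => ?_
    rw [← Finset.sum_add_distrib]
    refine Finset.sum_eq_zero fun j _ => ?_
    by_cases h : j = k
    · rw [if_pos h, if_pos h, add_zero]
    · rw [if_neg h, if_neg h, hg k j, neg_add_cancel]
  linarith [hswap, hsum]

/-- **Pair symmetrization: `Σ_k Σ_{j ≠ k} x_k∕(x_k − x_j) = (t+1)t∕2`** for distinct `x_0, …, x_t` (each pair contributes `x_k∕(x_k−x_j) + x_j∕(x_j−x_k) = 1`). [bookkeeping; this file, §1163] -/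
theorem sum_sum_erase_mul_inv_sub {t : ℕ} {x : Fin (t + 1) → ℝ} (hx : Function.Injective x) :
    ∑ k, ∑ j ∈ Finset.univ.erase k, x k * (x k - x j)⁻¹ = ((t : ℝ) + 1) * t / 2 := by
  -- `x_k/(x_k − x_j) = ½ + ½ (x_k + x_j)/(x_k − x_j)`, the second kernel antisymmetric
  have hsplit : ∀ k, ∀ j ∈ Finset.univ.erase k, x k * (x k - x j)⁻¹ = 1 / 2 + (x k + x j) / (2 * (x k - x j)) := fun k j hj => by
    have hne : x k - x j ≠ 0 := sub_ne_zero.2 fun h => (Finset.mem_erase.1 hj).1 (hx h).symm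
    field_simp; ring
  have hanti := sum_sum_erase_antisymm (fun k j : Fin (t + 1) => (x k + x j) / (2 * (x k - x j))) fun k j => by
    show (x k + x j) / (2 * (x k - x j)) = -((x j + x k) / (2 * (x j - x k)))
    rw [← div_neg, show -(2 * (x j - x k)) = 2 * (x k - x j) by ring, add_comm]
  have hcard : ∀ k : Fin (t + 1), (Finset.univ.erase k).card = t := fun k => by
    rw [Finset.card_erase_of_mem (Finset.mem_univ _), Finset.card_univ, Fintype.card_fin, Nat.add_sub_cancel]
  calc ∑ k, ∑ j ∈ Finset.univ.erase k, x k * (x k - x j)⁻¹ = ∑ k, ∑ j ∈ Finset.univ.erase k, (1 / 2 + (x k + x j) / (2 * (x k - x j))) :=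
        Finset.sum_congr rfl fun k _ => Finset.sum_congr rfl (hsplit k)
    _ = ∑ k : Fin (t + 1), ((t : ℝ) * (1 / 2) + ∑ j ∈ Finset.univ.erase k, (x k + x j) / (2 * (x k - x j))) :=
        Finset.sum_congr rfl fun k _ => by rw [Finset.sum_add_distrib, Finset.sum_const, hcard, nsmul_eq_mul]
    _ = ((t : ℝ) + 1) * t / 2 := by
        rw [Finset.sum_add_distrib, hanti, add_zero, Finset.sum_const, Finset.card_univ, Fintype.card_fin, nsmul_eq_mul]; push_cast; ring

/-- **LAGUERRE: `Σ_k 1∕x_k = (t+1)∕(α+1)`** for the zeros of `L^{(α)}_{t+1}` (`α > −1`; the hypotheses of N389). [Ahmed et al. 1979; Szegő §6.7; this file, §1163] -/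
theorem laguerre_zeros_sum_inv {L : ℕ → ℝ[X]} {a b : ℕ → ℝ} {α : ℝ} (hL0 : L 0 = 1) (hL1 : L 1 = Polynomial.X - C (a 0))
    (hLrec : ∀ n, L (n + 2) = (Polynomial.X - C (a (n + 1))) * L (n + 1) - C (b (n + 1)) * L n) (ha : ∀ n, a n = 2 * n + 1 + α)
    (hb : ∀ n, b (n + 1) = ((n : ℝ) + 1) * ((n : ℝ) + 1 + α)) (hα : -1 < α) {t : ℕ} {x : Fin (t + 1) → ℝ} (hx : StrictMono x)
    (hxq : L (t + 1) = ∏ k, (Polynomial.X - C (x k))) (hpos : ∀ k, 0 < x k) : ∑ k, (x k)⁻¹ = ((t : ℝ) + 1) / (α + 1) := by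
  have hel := fun k => laguerre_zeros_electrostatic hL0 hL1 hLrec ha hb hx hxq hpos k
  have hanti := sum_sum_erase_antisymm (fun k j : Fin (t + 1) => (x k - x j)⁻¹) fun k j => by rw [← inv_neg, neg_sub]
  rw [Finset.sum_congr rfl fun k _ => hel k] at hanti
  -- `Σ (x_k − α − 1)/(2 x_k) = 0`, i.e. `(t+1)/2 = (α+1)/2 · Σ 1/x_k`
  have hterm : ∀ k, (x k - α - 1) / (2 * x k) = 1 / 2 - (α + 1) / 2 * (x k)⁻¹ := fun k => by
    have := (hpos k).ne'; field_simp; ring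
  simp_rw [hterm, Finset.sum_sub_distrib, Finset.sum_const, Finset.card_univ, Fintype.card_fin, ← Finset.mul_sum] at hanti
  rw [nsmul_eq_mul] at hanti
  have hα1 : α + 1 ≠ 0 := by linarith
  rw [eq_div_iff hα1]
  push_cast at hanti
  linarith

/-- **GEGENBAUER: `Σ_k 1∕(1 − x_k²) = (t+1)(t+1+2λ)∕(2λ+1)`** for the zeros of `C^{(λ)}_{t+1}` (`λ > 0`). [Ahmed et al. 1979; Case 1980; this file, §1163] -/
theorem gegenbauer_zeros_sum_inv_one_sub_sq {q : ℕ → ℝ[X]} {a b : ℕ → ℝ} {lam : ℝ} (hq0 : q 0 = 1) (hq1 : q 1 = Polynomial.X - C (a 0))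
    (hrec : ∀ n, q (n + 2) = (Polynomial.X - C (a (n + 1))) * q (n + 1) - C (b (n + 1)) * q n) (ha : ∀ n, a n = 0)
    (hb : ∀ n, b (n + 1) = ((n : ℝ) + 1) * ((n : ℝ) + 2 * lam) / (4 * ((n : ℝ) + 1 + lam) * ((n : ℝ) + lam))) (hlam : 0 < lam)
    {t : ℕ} {x : Fin (t + 1) → ℝ} (hx : StrictMono x) (hxq : q (t + 1) = ∏ k, (Polynomial.X - C (x k))) (hmem : ∀ k, -1 < x k ∧ x k < 1) :
    ∑ k, (1 - x k ^ 2)⁻¹ = ((t : ℝ) + 1) * ((t : ℝ) + 1 + 2 * lam) / (2 * lam + 1) := by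
  have hel := fun k => gegenbauer_zeros_electrostatic hq0 hq1 hrec ha hb hlam hx hxq hmem k
  have hpair := sum_sum_erase_mul_inv_sub hx.injective
  simp_rw [← Finset.mul_sum] at hpair
  rw [Finset.sum_congr rfl fun k _ => by rw [hel k]] at hpair
  -- `x_k · (2λ+1) x_k/(2(1−x_k²)) = (2λ+1)/2 · (1/(1−x_k²) − 1)`
  have hterm : ∀ k, x k * ((2 * lam + 1) * x k / (2 * (1 - x k ^ 2))) = (2 * lam + 1) / 2 * (1 - x k ^ 2)⁻¹ - (2 * lam + 1) / 2 := fun k => by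
    have h1 : 1 - x k ^ 2 ≠ 0 := by nlinarith [(hmem k).1, (hmem k).2]
    field_simp; ring
  simp_rw [hterm, Finset.sum_sub_distrib, Finset.sum_const, Finset.card_univ, Fintype.card_fin, ← Finset.mul_sum, nsmul_eq_mul] at hpair
  push_cast at hpair
  have h21 : 2 * lam + 1 ≠ 0 := by linarith
  rw [eq_div_iff h21]
  linarith

/-- **LEGENDRE: `Σ_k 1∕(1 − x_k²) = (t+1)(t+2)∕2`** for the zeros of `P_{t+1}`. [Ahmed et al. 1979; Case 1980; this file, §1163] -/
theorem legendre_zeros_sum_inv_one_sub_sq {q : ℕ → ℝ[X]} {a b : ℕ → ℝ} (hq0 : q 0 = 1) (hq1 : q 1 = Polynomial.X - C (a 0))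
    (hrec : ∀ n, q (n + 2) = (Polynomial.X - C (a (n + 1))) * q (n + 1) - C (b (n + 1)) * q n) (ha : ∀ n, a n = 0)
    (hb : ∀ n, b (n + 1) = ((n : ℝ) + 1) ^ 2 / (4 * ((n : ℝ) + 1) ^ 2 - 1))
    {t : ℕ} {x : Fin (t + 1) → ℝ} (hx : StrictMono x) (hxq : q (t + 1) = ∏ k, (Polynomial.X - C (x k))) (hmem : ∀ k, -1 < x k ∧ x k < 1) :
    ∑ k, (1 - x k ^ 2)⁻¹ = ((t : ℝ) + 1) * ((t : ℝ) + 2) / 2 := by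
  have hb' : ∀ n : ℕ, b (n + 1) = ((n : ℝ) + 1) * ((n : ℝ) + 2 * (1 / 2)) / (4 * ((n : ℝ) + 1 + 1 / 2) * ((n : ℝ) + 1 / 2)) := fun n => by
    rw [hb]
    have h0 : (0 : ℝ) ≤ n := Nat.cast_nonneg n
    have h1 : 4 * ((n : ℝ) + 1) ^ 2 - 1 ≠ 0 := by nlinarith
    have h2 : 4 * ((n : ℝ) + 1 + 1 / 2) * ((n : ℝ) + 1 / 2) ≠ 0 := by positivity
    rw [div_eq_div_iff h1 h2]; ring
  rw [gegenbauer_zeros_sum_inv_one_sub_sq hq0 hq1 hrec ha hb' (by norm_num) hx hxq hmem]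
  ring

end Summit.Ventures.HSemireg.Wedge.HankelOuter
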